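import Summits.CriticalPhenomena.PercolationContinuityZ3.Theorems.PercNearOneGluingNoHeavyPcintKernNFZ3B9Defs
import Summits.CriticalPhenomena.PercolationContinuityZ3.Theorems.PercNearOneGluingNoHeavyPcintWinKernelTree
import Summits.CriticalPhenomena.PercolationContinuityZ3.Theorems.PercNearOneGluingNoHeavyPcintWinKernelNFP
import HarnessLib

/-!
# PCINT lane, kernel check 41/82 of the B3r window certificate `d = 3`, memory 9 (8-step windows; 39168 first-use normal forms of 1679616 codes): 4 prefix blocks, 560 rows

Cell `prim-pcint`, seat `prim-pcint-2` (gen 2).  Collatz–Wielandt rows `10^5 · row ≤ 99999 · DEN · v` on the normal forms extending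
each listed 5-step prefix (`WinK.nfCodesP`, `…PcintWinKernelNFP`; no global enumeration), by `decide +kernel` (`WinK.allB`;
table values from the search tree `WinK.KT.ofListF 15 tbl`, `…PcintWinKernelTree`; `maxHeartbeats 0`).  Does NOT build on p205010.
-/

namespace Summit.CriticalPhenomena.PercolationContinuityZ3.Theorems.Pcint.NFZ3B9

set_option maxHeartbeats 0 in
/-- The 140 rows of the normal forms extending the prefix `[((0 : Fin 3), true), ((1 : Fin 3), true), ((0 : Fin 3), false), ((1 : Fin 3), true), ((0 : Fin 3), true)]` (scan state 2) hold. [folklore] -/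
theorem leaf_133 : (WinK.nfCodesP 3 8 2 [((0 : Fin 3), true), ((1 : Fin 3), true), ((0 : Fin 3), false), ((1 : Fin 3), true), ((0 : Fin 3), true)]).all (WinK.rowOKBT 3 7 2204 10252 9755 99999 (WinK.KT.ofListF 15 tbl) 24474) = true :=
  WinK.all_of_allB (fuel := 12) (by decide +kernel)

set_option maxHeartbeats 0 in
/-- The 140 rows of the normal forms extending the prefix `[((0 : Fin 3), true), ((1 : Fin 3), true), ((0 : Fin 3), false), ((1 : Fin 3), true), ((0 : Fin 3), false)]` (scan state 2) hold. [folklore] -/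
theorem leaf_134 : (WinK.nfCodesP 3 8 2 [((0 : Fin 3), true), ((1 : Fin 3), true), ((0 : Fin 3), false), ((1 : Fin 3), true), ((0 : Fin 3), false)]).all (WinK.rowOKBT 3 7 2204 10252 9755 99999 (WinK.KT.ofListF 15 tbl) 24474) = true :=
  WinK.all_of_allB (fuel := 12) (by decide +kernel)

set_option maxHeartbeats 0 in
/-- The 140 rows of the normal forms extending the prefix `[((0 : Fin 3), true), ((1 : Fin 3), true), ((0 : Fin 3), false), ((1 : Fin 3), true), ((1 : Fin 3), true)]` (scan state 2) hold. [folklore] -/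
theorem leaf_135 : (WinK.nfCodesP 3 8 2 [((0 : Fin 3), true), ((1 : Fin 3), true), ((0 : Fin 3), false), ((1 : Fin 3), true), ((1 : Fin 3), true)]).all (WinK.rowOKBT 3 7 2204 10252 9755 99999 (WinK.KT.ofListF 15 tbl) 24474) = true :=
  WinK.all_of_allB (fuel := 12) (by decide +kernel)

set_option maxHeartbeats 0 in
/-- The 140 rows of the normal forms extending the prefix `[((0 : Fin 3), true), ((1 : Fin 3), true), ((0 : Fin 3), false), ((1 : Fin 3), true), ((1 : Fin 3), false)]` (scan state 2) hold. [folklore] -/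
theorem leaf_136 : (WinK.nfCodesP 3 8 2 [((0 : Fin 3), true), ((1 : Fin 3), true), ((0 : Fin 3), false), ((1 : Fin 3), true), ((1 : Fin 3), false)]).all (WinK.rowOKBT 3 7 2204 10252 9755 99999 (WinK.KT.ofListF 15 tbl) 24474) = true :=
  WinK.all_of_allB (fuel := 12) (by decide +kernel)

end Summit.CriticalPhenomena.PercolationContinuityZ3.Theorems.Pcint.NFZ3B9
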